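import Summits.MatrixMultiplication.MatrixMultiplication.Theorems.EdgePencilTriangles
import HarnessLib

/-!
# The excess decomposition of the attacked leaf: `TetraFlat ⟺ (α ≥ 1/2) ∧ (ω(K₄) = ω(K₄ - e))`,
# and the weakened exact cut `ω = 2 ⟺ [ω(K₄) ≤ ω(2,1,2)] ∧ TetraNoSaving`

Support kernel for `stmt-MatrixMultiplication-33477` (`TetraFlat : ω(K₄) ≤ 4`) of route
`TetrahedronCarving` (lineage `decomp-mm-lens-6`, generation 20; barrier-complement carving).

By `EdgePencilTriangles` the diamond `K₄ - e` has the RECTANGULAR exponent `ψ(1) = ω(2,1,2) =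
2·ω(1,1/2,1)`, which is also the grouping floor of the tetrahedron: `ω(2,1,2) ≤ ω(K₄) ≤ 2ω`. Call
`e := ω(K₄) − ω(2,1,2) ∈ [0, 2ω − ω(2,1,2)]` the NON-RECTANGULAR EXCESS of the tetrahedron — the
exponent cost of gluing the sixth edge (an EPR pair between the two apexes) onto the diamond.

* §1 `TetraFlat ⟺ (1/2 ≤ α) ∧ (e = 0)` (`tetraFlat_iff_halfAlpha_and_excessZero`): the attacked leaf
  splits, with a PROVED trivial assembly, into its rectangular shadow `α ≥ 1/2` (`ω(2,1,2) = 4`; inside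
  the laser-method world, below the Christandl–Le Gall–Lysikov–Zuiddam `CW`-barrier `0.625` for `α`) and
  the purely tensorial statement `ExcessZero : ω(K₄) ≤ ω(2,1,2)` («the tetrahedron costs no more than
  the diamond»).
* §2 **The weakened exact cut** `ω = 2 ⟺ ExcessZero ∧ TetraNoSaving`
  (`matrixMultiplication_iff_excessZero_and_tetraNoSaving`): in the cut of record
  `ω = 2 ⟺ TetraFlat ∧ TetraNoSaving` the attacked leaf `TetraFlat` may be replaced by its strictly
  weaker conjunct `ExcessZero` (`2ω ≤ ω(K₄) ≤ ω(2,1,2) ≤ ω + 2 ⟹ ω ≤ 2`), the residual unchanged.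
  Both `ExcessZero` and `α ≥ 1/2` are NEC (`ω = 2 ⟹` each).
* §3 Consequences of `ExcessZero`: `ω(K₄) ≤ 2ω(1,1/2,1) ≤ 4 + (1−2a)/(1−a)·(ω − 2)` for every
  `a ≤ min(α, 1/2)` (convexity of `k ↦ ω(1,k,1)` and its flat segment), in particular `≤ ω + 2`; so
  `ExcessZero` predicts `ω(K₄)` at most `≈ 4.2` from the record `α > 0.3213`, `ω < 2.3714` (and `≈ 4.09`
  from the tabulated `ω(1,0.5,1)`), strictly below the printed `ω(K₄) < 4.633908`, without implying `4`.
* §4 Independence models (`ExcessWeb`): over the inequalities recorded in the tree between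
  `ω, ω(1,1/2,1), ω(K₄)` — including the two new laws `2ω(1,1/2,1) ≤ ω(K₄)` and the chord costume —
  `ExcessZero` holds in a world with `ω ≠ 2`, `α < 1/2`, `ω(K₄) > 4` (so it implies neither the summit
  nor `TetraFlat` nor `α ≥ 1/2` by bookkeeping) and fails in another where `α ≥ 1/2` holds: the two
  conjuncts of `TetraFlat` are independent and each is strictly weaker than the leaf, relative to the record.

References: Christandl–Vrana–Zuiddam, arXiv:1609.07476, §1.2–1.3, Prop. 1.1.26; Lotti–Romani 1983;
Christandl–Le Gall–Lysikov–Zuiddam, arXiv:2003.03019, Thm. 1.2 (`α`-barrier `0.625` for `CW`-methods);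
Coppersmith 1982 (`α > 0`). [ChristandlVranaZuiddam2016] [LottiRomani1983]
[ChristandlLeGallLysikovZuiddam2025] [Coppersmith1982]
-/

noncomputable section

set_option linter.dupNamespace false

open Literature.Computability.AlgebraicComplexity
open Summit.MatrixMultiplication.MatrixMultiplication.Theorems.TetrahedronTensor
open Summit.MatrixMultiplication.MatrixMultiplication.Theses.TetrahedronCarving

namespace Summit.MatrixMultiplication.MatrixMultiplication.Theorems.EdgePencil

/-! ## §1 The excess and the split of the attacked leaf -/

section Excess

variable (F : Type) [Field F]

/-- The non-rectangular excess `ω(K₄) − ω(2,1,2)` lies in `[0, 2ω − ω(2,1,2)]`. -/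
theorem excess_window :
    0 ≤ omegaTetra F - omegaRect F 2 1 2 ∧
      omegaTetra F - omegaRect F 2 1 2 ≤ 2 * omega F - omegaRect F 2 1 2 :=
  ⟨sub_nonneg.2 (omegaRect_two_one_two_le_omegaTetra F),
    by linarith [omegaTetra_le_two_mul_omega F]⟩

/-- `ω(2,1,2) ≤ 4 ⟺ α ≥ 1/2` (`ω(2,1,2) = 2ω(1,1/2,1) ≥ 4` always). [cite: LeGall2012, §1] -/
theorem omegaRect_two_one_two_le_four_iff_half_le_dualExponentAlpha :
    omegaRect F 2 1 2 ≤ 4 ↔ 1 / 2 ≤ dualExponentAlpha F := by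
  rw [← omegaPencil_one_eq_omegaRect_two_one_two]
  exact diamondFlat_iff_half_le_dualExponentAlpha F

/-- `ω(2,1,2) = 4 ⟺ α ≥ 1/2`. [cite: LeGall2012, §1] -/
theorem omegaRect_two_one_two_eq_four_iff_half_le_dualExponentAlpha :
    omegaRect F 2 1 2 = 4 ↔ 1 / 2 ≤ dualExponentAlpha F := by
  rw [← omegaRect_two_one_two_le_four_iff_half_le_dualExponentAlpha]
  exact ⟨fun h => h.le, fun h => le_antisymm h (four_le_omegaRect_two_one_two F)⟩

/-- `ExcessZero` as a value statement: `ω(K₄) ≤ ω(2,1,2) ⟺ ω(K₄) = ω(2,1,2)`. -/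
theorem excessZero_iff_eq : omegaTetra F ≤ omegaRect F 2 1 2 ↔ omegaTetra F = omegaRect F 2 1 2 :=
  ⟨fun h => le_antisymm h (omegaRect_two_one_two_le_omegaTetra F), fun h => h.le⟩

/-- `ExcessZero` ⟺ «the sixth edge is free»: `ω(K₄) = ψ(1) = ω(K₄ - e)`. -/
theorem excessZero_iff_omegaTetra_eq_omegaPencil_one :
    omegaTetra F ≤ omegaRect F 2 1 2 ↔ omegaTetra F = omegaPencil F 1 := by
  rw [excessZero_iff_eq, omegaPencil_one_eq_omegaRect_two_one_two]

/-- **THE EXCESS DECOMPOSITION OF THE ATTACKED LEAF**: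
`TetraFlat ⟺ (1/2 ≤ α) ∧ (ω(K₄) ≤ ω(2,1,2))` — the rectangular shadow and the non-rectangular excess,
with the trivial proved assembly `ω(K₄) ≤ ω(2,1,2) = 4`. [cite: ChristandlVranaZuiddam2016, §1.3] -/
theorem tetraFlat_iff_halfAlpha_and_excessZero :
    TetraFlat ↔ 1 / 2 ≤ dualExponentAlpha ℂ ∧ omegaTetra ℂ ≤ omegaRect ℂ 2 1 2 := by
  constructor
  · intro h
    exact ⟨half_le_dualExponentAlpha_of_tetraFlat h,
      le_trans (show omegaTetra ℂ ≤ 4 from h) (four_le_omegaRect_two_one_two ℂ)⟩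
  · rintro ⟨hα, hE⟩
    have h4 := (omegaRect_two_one_two_eq_four_iff_half_le_dualExponentAlpha ℂ).2 hα
    show omegaTetra ℂ ≤ 4
    rw [← h4]
    exact hE

/-- `TetraFlat ⟹ ExcessZero`. -/
theorem excessZero_of_tetraFlat (h : TetraFlat) : omegaTetra ℂ ≤ omegaRect ℂ 2 1 2 :=
  (tetraFlat_iff_halfAlpha_and_excessZero.1 h).2

/-! ## §2 The weakened exact cut -/

/-- NEC: `ω = 2 ⟹ ExcessZero`. -/
theorem excessZero_of_matrixMultiplication (hS : _root_.MatrixMultiplication) :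
    omegaTetra ℂ ≤ omegaRect ℂ 2 1 2 :=
  excessZero_of_tetraFlat (omegaTetra_le_four_of_matrixMultiplication hS)

/-- NEC: `ω = 2 ⟹ α ≥ 1/2`. -/
theorem halfAlpha_of_matrixMultiplication (hS : _root_.MatrixMultiplication) :
    1 / 2 ≤ dualExponentAlpha ℂ :=
  half_le_dualExponentAlpha_of_tetraFlat (omegaTetra_le_four_of_matrixMultiplication hS)

/-- SUFFICIENCY over any field: `ω(K₄) ≤ ω(2,1,2)` and `2ω ≤ ω(K₄)` give `ω = 2`
(`ω(2,1,2) = ψ(1) ≤ ω + 2`, the cherry cover). -/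
theorem omega_eq_two_of_excessZero_of_noSaving (hE : omegaTetra F ≤ omegaRect F 2 1 2)
    (hB : 2 * omega F ≤ omegaTetra F) : omega F = 2 := by
  have hc := omegaPencil_one_le_omega_add_two F
  rw [omegaPencil_one_eq_omegaRect_two_one_two] at hc
  exact le_antisymm (by linarith) (omega_two_le F)

/-- **THE WEAKENED EXACT CUT**: `ω = 2 ⟺ [ω(K₄) ≤ ω(2,1,2)] ∧ TetraNoSaving` — the cut of record
`TetraFlat ∧ TetraNoSaving` with the attacked leaf replaced by its non-rectangular conjunct.
[cite: ChristandlVranaZuiddam2016, §1.3] -/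
theorem matrixMultiplication_iff_excessZero_and_tetraNoSaving :
    _root_.MatrixMultiplication ↔ omegaTetra ℂ ≤ omegaRect ℂ 2 1 2 ∧ TetraNoSaving :=
  ⟨fun hS => ⟨excessZero_of_matrixMultiplication hS, (matrixMultiplication_iff_tetra.1 hS).2⟩,
    fun h => _root_.MatrixMultiplication_iff.2 (omega_eq_two_of_excessZero_of_noSaving ℂ h.1 h.2)⟩

/-- The same cut with the pencil exponent: `ω = 2 ⟺ [ω(K₄) ≤ ψ(1)] ∧ [2ω ≤ ω(K₄)]`
(«closing the diamond is free» ∧ «no saving over two triangles»). -/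
theorem matrixMultiplication_iff_sixthEdgeFree_and_noSaving :
    _root_.MatrixMultiplication ↔ omegaTetra ℂ ≤ omegaPencil ℂ 1 ∧ 2 * omega ℂ ≤ omegaTetra ℂ := by
  rw [matrixMultiplication_iff_excessZero_and_tetraNoSaving, omegaPencil_one_eq_omegaRect_two_one_two]
  rfl

/-- Under `ExcessZero` the residual reads `2ω ≤ ω(2,1,2)`, i.e. `ω ≤ ω(1,1/2,1)`, and the three
pieces recombine: `ω = 2 ⟺ (α ≥ 1/2) ∧ ExcessZero ∧ TetraNoSaving`. -/
theorem matrixMultiplication_iff_halfAlpha_excessZero_noSaving :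
    _root_.MatrixMultiplication ↔
      1 / 2 ≤ dualExponentAlpha ℂ ∧ omegaTetra ℂ ≤ omegaRect ℂ 2 1 2 ∧ TetraNoSaving := by
  rw [matrixMultiplication_iff_tetra, ← and_assoc]
  show omegaTetra ℂ ≤ 4 ∧ _ ↔ _
  exact and_congr_left fun _ => tetraFlat_iff_halfAlpha_and_excessZero

/-! ## §3 What `ExcessZero` predicts -/

/-- `ExcessZero ⟹ ω(K₄) ≤ 2·ω(1,1/2,1) ≤ ω + 2`. -/
theorem omegaTetra_le_of_excessZero (hE : omegaTetra F ≤ omegaRect F 2 1 2) :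
    omegaTetra F ≤ 2 * omegaRect F 1 (1 / 2) 1 ∧ omegaTetra F ≤ omega F + 2 := by
  have h1 := omegaPencil_one_eq F
  have h2 := omegaPencil_one_eq_omegaRect_two_one_two F
  have hc := omegaPencil_one_le_omega_add_two F
  constructor <;> linarith

/-- Convexity with the flat segment: `ω(1,1/2,1) ≤ 2 + (1/2 − a)/(1 − a)·(ω − 2)` for
`0 ≤ a ≤ 1/2`, `a ≤ α`. [cite: LottiRomani1983, §3] -/
theorem omegaRect_half_le_chord {a : ℝ} (ha0 : 0 ≤ a) (ha : a ≤ 1 / 2)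
    (hα : a ≤ dualExponentAlpha F) :
    omegaRect F 1 (1 / 2) 1 ≤ 2 + (1 / 2 - a) / (1 - a) * (omega F - 2) := by
  have hconv := omegaRect_convexOn_middle_holds F
  have hfa : omegaRect F 1 a 1 = 2 := omegaRect_eq_two_of_le_dualExponentAlpha F hα
  have h1a : 0 < 1 - a := by linarith
  -- `1/2 = t·a + s·1` with `t = (1/2)/(1-a)`, `s = (1/2 - a)/(1-a)`
  set t : ℝ := (1 / 2) / (1 - a) with ht
  set s : ℝ := (1 / 2 - a) / (1 - a) with hs
  have ht0 : 0 ≤ t := div_nonneg (by norm_num) h1a.le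
  have hs0 : 0 ≤ s := div_nonneg (by linarith) h1a.le
  have hts : t + s = 1 := by
    rw [ht, hs, ← add_div, div_eq_one_iff_eq h1a.ne']
    ring
  have hmid : t * a + s * (1 : ℝ) = 1 / 2 := by
    rw [ht, hs, div_mul_eq_mul_div, mul_one, ← add_div, div_eq_iff h1a.ne']
    ring
  have h := hconv.2 (Set.mem_Ici.2 ha0) (Set.mem_Ici.2 zero_le_one) ht0 hs0 hts
  simp only [smul_eq_mul] at h
  rw [hmid, hfa, omegaRect_one_one_one] at h
  -- `h : ω(1,1/2,1) ≤ t·2 + s·ω`; and `t·2 + s·ω = 2 + s(ω - 2)` since `t + s = 1`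
  have : t * 2 + s * omega F = 2 + s * (omega F - 2) := by
    have : t = 1 - s := by linarith
    rw [this]; ring
  linarith

/-- **`ExcessZero ⟹ ω(K₄) ≤ 4 + (1 − 2a)/(1 − a)·(ω − 2)`** for every `0 ≤ a ≤ 1/2` with `a ≤ α`
(`a = 0`: `ω + 2`; with the record `a = 0.3213`, `ω < 2.3714`: `< 4.2`, below the printed
`ω(K₄) < 4.633908` and above `4`). [cite: ChristandlVranaZuiddam2016, §1.2 (table)] -/
theorem omegaTetra_le_chord_of_excessZero {a : ℝ} (ha0 : 0 ≤ a) (ha : a ≤ 1 / 2)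
    (hα : a ≤ dualExponentAlpha F) (hE : omegaTetra F ≤ omegaRect F 2 1 2) :
    omegaTetra F ≤ 4 + (1 - 2 * a) / (1 - a) * (omega F - 2) := by
  have h1 := (omegaTetra_le_of_excessZero F hE).1
  have h2 := omegaRect_half_le_chord F ha0 ha hα
  have h1a : 0 < 1 - a := by linarith
  have hid : (1 - 2 * a) / (1 - a) = 2 * ((1 / 2 - a) / (1 - a)) := by
    rw [mul_div_assoc']
    congr 1
    ring
  rw [hid]
  linarith

/-- Numerical instance: if `0.3213 ≤ α` and `ω ≤ 2.3714` then `ExcessZero ⟹ ω(K₄) < 4.2`. -/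
theorem omegaTetra_lt_of_excessZero_record (hα : (0.3213 : ℝ) ≤ dualExponentAlpha F)
    (hω : omega F ≤ 2.3714) (hE : omegaTetra F ≤ omegaRect F 2 1 2) : omegaTetra F < 4.2 := by
  have h := omegaTetra_le_chord_of_excessZero F (a := 0.3213) (by norm_num) (by norm_num) hα hE
  have hω2 := omega_two_le F
  have hc : (1 - 2 * (0.3213 : ℝ)) / (1 - 0.3213) * (omega F - 2) ≤ 0.5266 * (omega F - 2) := by
    apply mul_le_mul_of_nonneg_right _ (by linarith)
    rw [div_le_iff₀ (by norm_num)]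
    norm_num
  linarith

end Excess

/-! ## §4 Independence models over the recorded inequalities -/

/-- A model of the inequalities the tree records between `ω` (`om`), `ω(1,1/2,1)` (`mid`) and
`ω(K₄)` (`tet`): flattening, `mid ≥ 2`, convexity `mid ≤ (2 + ω)/2`, the chord costume
`mid = (2+ω)/2 → ω = 2` (`EdgePencilExponent`, given `α > 0`), the grouping floor `2·mid ≤ ω(K₄)`
(`= ω(2,1,2) ≤ ω(K₄)`), the cover `ω(K₄) ≤ 2ω`, and the Lotti–Romani shadow `ω(K₄) ≤ 4 → ω ≤ 12/5`. -/
structure ExcessWeb where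
  /-- stands for `ω` -/
  om : ℝ
  /-- stands for `ω(1,1/2,1)` -/
  mid : ℝ
  /-- stands for `ω(K₄)` -/
  tet : ℝ
  two_le_om : 2 ≤ om
  two_le_mid : 2 ≤ mid
  mid_le_avg : mid ≤ (2 + om) / 2
  chord_costume : mid = (2 + om) / 2 → om = 2
  two_mid_le_tet : 2 * mid ≤ tet
  tet_le_two_om : tet ≤ 2 * om
  shadow : tet ≤ 4 → om ≤ 12 / 5

namespace ExcessWeb

/-- In every web the weakened cut decides: `tet ≤ 2·mid ∧ 2·om ≤ tet → om = 2`. -/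
theorem om_eq_two_of_cut (W : ExcessWeb) (hE : W.tet ≤ 2 * W.mid) (hB : 2 * W.om ≤ W.tet) :
    W.om = 2 := by
  have := W.mid_le_avg
  have := W.two_le_om
  linarith

/-- In every web `TetraFlat ⟺ HalfAlpha ∧ ExcessZero` (`tet ≤ 4 ⟺ mid = 2 ∧ tet ≤ 2 mid`). -/
theorem flat_iff (W : ExcessWeb) : W.tet ≤ 4 ↔ W.mid = 2 ∧ W.tet ≤ 2 * W.mid := by
  have := W.two_le_mid
  have := W.two_mid_le_tet
  constructor
  · intro h
    exact ⟨by linarith, by linarith⟩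
  · rintro ⟨h1, h2⟩
    linarith

/-- A web at the record `ω = 2.37` in which `α ≥ 1/2` HOLDS (`mid = 2`) but the excess is positive
(`ω(K₄) = 4.5 > 4 = ω(2,1,2)`). -/
def halfAlphaWorld : ExcessWeb where
  om := 2.37
  mid := 2
  tet := 4.5
  two_le_om := by norm_num
  two_le_mid := by norm_num
  mid_le_avg := by norm_num
  chord_costume := by norm_num
  two_mid_le_tet := by norm_num
  tet_le_two_om := by norm_num
  shadow := by norm_num

/-- A web at `ω = 2.37` in which the excess VANISHES (`ω(K₄) = ω(2,1,2) = 4.1`) but `α < 1/2`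
(`mid = 2.05 > 2`), `ω(K₄) > 4`, `ω ≠ 2`. -/
def excessZeroWorld : ExcessWeb where
  om := 2.37
  mid := 2.05
  tet := 4.1
  two_le_om := by norm_num
  two_le_mid := by norm_num
  mid_le_avg := by norm_num
  chord_costume := by norm_num
  two_mid_le_tet := by norm_num
  tet_le_two_om := by norm_num
  shadow := by norm_num

/-- **`ExcessZero` is undecided by the record and implies neither the summit, nor `TetraFlat`, nor
`α ≥ 1/2` by bookkeeping**; and it fails in a web where `α ≥ 1/2` holds. -/
theorem excessZero_undecided :
    (excessZeroWorld.tet ≤ 2 * excessZeroWorld.mid ∧ excessZeroWorld.om ≠ 2 ∧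
        ¬ excessZeroWorld.tet ≤ 4 ∧ excessZeroWorld.mid ≠ 2) ∧
      ¬ halfAlphaWorld.tet ≤ 2 * halfAlphaWorld.mid := by
  refine ⟨⟨by norm_num [excessZeroWorld], by norm_num [excessZeroWorld],
    by norm_num [excessZeroWorld], by norm_num [excessZeroWorld]⟩, by norm_num [halfAlphaWorld]⟩

/-- **`α ≥ 1/2` is undecided by the record and does not give `ExcessZero` or `TetraFlat`**. -/
theorem halfAlpha_undecided :
    (halfAlphaWorld.mid = 2 ∧ halfAlphaWorld.om ≠ 2 ∧ ¬ halfAlphaWorld.tet ≤ 4) ∧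
      excessZeroWorld.mid ≠ 2 := by
  refine ⟨⟨by norm_num [halfAlphaWorld], by norm_num [halfAlphaWorld],
    by norm_num [halfAlphaWorld]⟩, by norm_num [excessZeroWorld]⟩

end ExcessWeb

end Summit.MatrixMultiplication.MatrixMultiplication.Theorems.EdgePencil

end
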